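import Literature.MathematicalPhysics.QuantumLattice.YangMillsHeatFlowContinuation
import Literature.MathematicalPhysics.QuantumLattice.YangMillsHeatFlowGauge
import HarnessLib

/-!
# Yang–Mills heat flow: the DeTurck trick — short-time existence from semilinear parabolic theory

Sorry-free progress on the named fact
`Literature.MathematicalPhysics.QuantumLattice.Waldron2019_yangMillsFlow_flatTorus` (Waldron 2019,
Cor. 1.2 with Struwe's short-time existence), step (S1) of the published architecture, after
`YangMillsHeatFlowGauge.lean` (gauge covariance, time-dependent gauge transformations, the gauge
ODE) and `YangMillsHeatFlowContinuation.lean` (Cor. 1.2 from Thm. 1.1 and short-time existence).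
Short-time existence for the Yang–Mills heat flow `∂ₜ A = −D_A^* F_A` is proved in the literature
(Donaldson–Kronheimer, *The Geometry of Four-Manifolds*, §6.3.1; Struwe 1994, §4.1 "Donaldson's
Ansatz", (16)–(18)) by the **DeTurck trick**: the modified flow `∂ₜ Ã = −D_Ã^* F_Ã + D_Ã φ(Ã)` with
`φ(Ã) = −D_Ã^*(Ã − A₀)` is strictly parabolic — its right-hand side is the flat Laplacian `ΔÃ`
plus terms of order `≤ 1` — hence solvable for short time by standard parabolic theory, and the
time-dependent gauge transformation `g` with `∂ₜ g = g φ(Ã)`, `g(0) = 1` turns `Ã` into a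
solution `A = g • Ã` of the Yang–Mills heat flow with the same initial value. This file proves
that reduction on the flat torus `ℝ⁴/Lℤ⁴` (periodic formulation on `ℝ⁴`), leaving as the ONLY
hypothesis the semilinear parabolic existence theorem:

* `exists_contDiff_deTurck_eq` — **the algebra of the trick**: there is a smooth (polynomial)
  map `f₀` of the jets with `div_Ã F_Ã + D_Ã φ(Ã) = Σᵢ D²Ã(eᵢ, eᵢ) + f₀(jets of A₀, Ã, DÃ)`
  (flat space `E`, any coefficient algebra; second derivatives of `Ã` cancel down to the
  Laplacian by the symmetry of `D²Ã`), and `f₀` — a sum of commutators and of `−Σᵢ D²A₀(·,eᵢ,eᵢ)` —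
  preserves jets with values in any commutator-closed subspace `𝔤` (e.g. `𝔲(N)`);
* `fderiv_mem_of_forall_mem` (derivatives of maps into a closed subspace), `contDiffOn_deTurckPhi`,
  `deTurckPhi_comp_add`, `deTurckPhi_mem` (joint smoothness, periodicity and `𝔤`-values of `φ`);
* `gauge_comp_add_of_ode` (periodicity of `g`), `skewAdjoint_comm_mem`, `hasDerivAt_star_comp`,
  `fderiv_star_comp_apply`, `mul_star_eq_one_of_ode` (**unitarity of `g`** when `φ` is
  skew-adjoint: `(g g⋆)' = g (φ + φ⋆) g⋆ = 0`), for a finite-dimensional real normed star algebra;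
* `shortTime_of_semilinearHeat` — **short-time existence of classical solutions of the
  Yang–Mills heat flow for smooth periodic `𝔲`-valued data, from local well-posedness of
  semilinear heat systems `∂ₜ u = Σᵢ ∂ᵢ∂ᵢ u + f(x, u, ∂u)` on the flat torus** (hypothesis `hSL`;
  Taylor, *PDE III*, Ch. 15, §1): `hSL` solves the modified flow, `exists_gauge_of_ode` the gauge
  ODE, and `A = g • Ã` is jointly smooth, periodic, `𝔲`-valued (unitarity), starts at `A₀` and
  solves the flow (`deriv_gaugeAct_tslice_eq_divCurvature`);
* `Waldron2019_yangMillsFlow_flatTorus_of_semilinearHeat_of_smoothExtension` — **the named fact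
  from `hSL` and Waldron's Thm. 1.1 (`hW`, closed-slab smooth extension at finite times)**, via
  `Waldron2019_yangMillsFlow_flatTorus_of_shortTime_of_smoothExtension`.

With this file the formalization of Waldron's Cor. 1.2 on the flat torus rests on exactly two
analytic theorems: semilinear parabolic well-posedness (for (S1)) and Waldron's Thm. 1.1 ((S3),
no finite-time curvature concentration and the smooth limit, Waldron 2019 §§2–7). Everything is
proved; no definition and no named fact is introduced.

References: S. K. Donaldson, P. B. Kronheimer, *The Geometry of Four-Manifolds* (1990), §6.3.1
[DonaldsonKronheimer1990]; M. Struwe, *The Yang–Mills flow in four dimensions*,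
Calc. Var. 2 (1994), §4, (16)–(18), §4.1 [Struwe1994]; A. Waldron, *Long-time existence for Yang–Mills flow*,
Invent. Math. 217 (2019), §1, Thm. 1.1, Cor. 1.2, p. 3 [Waldron2019]; M. E. Taylor, *Partial
Differential Equations III* (2011), Ch. 15, §1 [TaylorPDEIII2011].
-/

noncomputable section

set_option maxSynthPendingDepth 3

open scoped ContDiff Topology
open Set Filter

namespace Literature.MathematicalPhysics.QuantumLattice

/-! ### The DeTurck-modified Yang–Mills vector field is the Laplacian plus lower-order terms -/

section DeTurckField

variable {E : Type*} [NormedAddCommGroup E] [InnerProductSpace ℝ E] [FiniteDimensional ℝ E]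
variable {𝔸 : Type*} [NormedRing 𝔸] [NormedAlgebra ℝ 𝔸]

set_option maxHeartbeats 800000 in
/-- **The DeTurck trick, algebraic part.** Let `e` be the standard orthonormal frame of `E` and,
for connections `Ã`, `A₀`, let `φ(Ã) = Σᵢ D_{eᵢ}((Ã − A₀)(eᵢ)) = −D_Ã^*(Ã − A₀)` (a `𝔤`-valued
function). There is a `C^∞` (polynomial) map `f₀` of the jets such that for all `C²` connections
`A₀`, `Ã` and all `x`, `v`:
`(div_Ã F_Ã)(x)(v) + (D_Ã φ(Ã))(x)(v) = Σᵢ D²Ã(x)(eᵢ, eᵢ)(v) + f₀((A₀(x), DA₀(x), D²A₀(x)), Ã(x), DÃ(x))(v)`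
— the modified Yang–Mills vector field `−D_Ã^* F_Ã + D_Ã φ(Ã)` is the flat Laplacian of `Ã`
plus terms of order `≤ 1` in `Ã` (its principal symbol is `|ξ|²`: the term `D_Ã φ` cancels the
degeneracy `ξ ⟨ξ, ·⟩` of `−D^* D`). Moreover `f₀` is a sum of commutators and of the term
`−Σᵢ D²A₀(x)(v, eᵢ, eᵢ)`, so it maps jets with values in a subspace `𝔤 ⊆ 𝔸` closed under
commutators (e.g. `𝔲(N) ⊆ M_N(ℂ)`) to `𝔤`-valued forms. Donaldson–Kronheimer §6.3.1;
Struwe 1994, §4.1, (17). [folklore] -/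
theorem exists_contDiff_deTurck_eq :
    ∃ f₀ : ((E →L[ℝ] 𝔸) × (E →L[ℝ] E →L[ℝ] 𝔸) × (E →L[ℝ] E →L[ℝ] E →L[ℝ] 𝔸)) ×
        (E →L[ℝ] 𝔸) × (E →L[ℝ] E →L[ℝ] 𝔸) → E →L[ℝ] 𝔸,
      ContDiff ℝ ∞ f₀ ∧
      (∀ 𝔤 : Submodule ℝ 𝔸, (∀ a b : 𝔸, a ∈ 𝔤 → b ∈ 𝔤 → a * b - b * a ∈ 𝔤) →
        ∀ q : ((E →L[ℝ] 𝔸) × (E →L[ℝ] E →L[ℝ] 𝔸) × (E →L[ℝ] E →L[ℝ] E →L[ℝ] 𝔸)) ×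
            (E →L[ℝ] 𝔸) × (E →L[ℝ] E →L[ℝ] 𝔸),
          (∀ v, q.1.1 v ∈ 𝔤) → (∀ u v, q.1.2.1 u v ∈ 𝔤) → (∀ u v w, q.1.2.2 u v w ∈ 𝔤) →
          (∀ v, q.2.1 v ∈ 𝔤) → (∀ u v, q.2.2 u v ∈ 𝔤) → ∀ v, f₀ q v ∈ 𝔤) ∧
      ∀ (A₀ Ã : Connection E 𝔸), ContDiff ℝ 2 A₀ → ContDiff ℝ 2 Ã → ∀ x v : E,
        divCurvature Ã x v +
            covDeriv Ã (fun y => ∑ i, covDeriv Ã (fun z => (Ã z - A₀ z) (stdOrthonormalBasis ℝ E i))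
              y (stdOrthonormalBasis ℝ E i)) x v =
          (∑ i, fderiv ℝ (fderiv ℝ Ã) x (stdOrthonormalBasis ℝ E i) (stdOrthonormalBasis ℝ E i)) v +
            f₀ ((A₀ x, fderiv ℝ A₀ x, fderiv ℝ (fderiv ℝ A₀) x), Ã x, fderiv ℝ Ã x) v := by
  set e := stdOrthonormalBasis ℝ E with he
  set μ : 𝔸 →L[ℝ] 𝔸 →L[ℝ] 𝔸 := ContinuousLinearMap.mul ℝ 𝔸 with hμ
  set ev : E → (E →L[ℝ] 𝔸) →L[ℝ] 𝔸 := fun u => ContinuousLinearMap.apply ℝ 𝔸 u with hev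
  set ev' : E → (E →L[ℝ] E →L[ℝ] 𝔸) →L[ℝ] (E →L[ℝ] 𝔸) :=
    fun u => ContinuousLinearMap.apply ℝ (E →L[ℝ] 𝔸) u with hev'
  -- `ad c = [c, ·]` as an operator on `𝔸`
  set ad : 𝔸 → 𝔸 →L[ℝ] 𝔸 := fun c => μ c - μ.flip c with had
  -- the jet variables: `q = ((b, b', b''), a, a')`
  set f₀ : ((E →L[ℝ] 𝔸) × (E →L[ℝ] E →L[ℝ] 𝔸) × (E →L[ℝ] E →L[ℝ] E →L[ℝ] 𝔸)) ×
      (E →L[ℝ] 𝔸) × (E →L[ℝ] E →L[ℝ] 𝔸) → E →L[ℝ] 𝔸 := fun q => ∑ i,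
    ((ad (q.2.1 (e i))).comp (q.2.2 (e i)) +                                   -- [a eᵢ, a' eᵢ ·]
      (ad (q.2.2 (e i) (e i))).comp q.2.1 +                                     -- [a' eᵢ eᵢ, a ·]
      (ad (q.2.1 (e i))).comp (q.2.2 (e i) - (ev (e i)).comp q.2.2 +
        (ad (q.2.1 (e i))).comp q.2.1) -                                        -- [a eᵢ, Fᵢ ·]
      (ev (e i)).comp ((ev' (e i)).comp q.1.2.2) +                              -- -b'' · eᵢ eᵢ
      (ad (q.1.1 (e i))).comp ((ev (e i)).comp q.2.2) -                         -- [b eᵢ, a' · eᵢ]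
      (ad (q.2.1 (e i))).comp ((ev (e i)).comp q.1.2.1) -                       -- -[a eᵢ, b' · eᵢ]
      (ad (q.2.2 (e i) (e i) - q.1.2.1 (e i) (e i) -
        (q.2.1 (e i) * q.1.1 (e i) - q.1.1 (e i) * q.2.1 (e i)))).comp q.2.1)   -- [a ·, cᵢ]
    with hf₀
  refine ⟨f₀, ?_, ?_, ?_⟩
  · -- smoothness: a polynomial in the jet variables
    simp only [hf₀, had]
    refine ContDiff.sum fun i _ => ?_
    fun_prop
  · -- preservation of a commutator-closed subspace
    intro 𝔤 h𝔤 q hb hb' hb'' ha ha' v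
    simp only [hf₀, had, hμ, hev, hev', sum_apply, add_apply, sub_apply,
      ContinuousLinearMap.comp_apply, ContinuousLinearMap.apply_apply,
      ContinuousLinearMap.mul_apply', ContinuousLinearMap.flip_apply]
    refine Submodule.sum_mem _ fun i _ => ?_
    have hc : ∀ c d : 𝔸, c ∈ 𝔤 → d ∈ 𝔤 → c * d - d * c ∈ 𝔤 := h𝔤
    apply_rules [Submodule.add_mem, Submodule.sub_mem, hc, hb, hb', hb'', ha, ha']
  · -- the identity
    intro A₀ Ã hA₀ hÃ x v
    -- notation for the jets at `x`
    have hdÃ : ∀ y, HasFDerivAt Ã (fderiv ℝ Ã y) y := fun y =>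
      (hÃ.differentiable two_ne_zero y).hasFDerivAt
    have hdA₀ : ∀ y, HasFDerivAt A₀ (fderiv ℝ A₀ y) y := fun y =>
      (hA₀.differentiable two_ne_zero y).hasFDerivAt
    have hdÃ' : HasFDerivAt (fderiv ℝ Ã) (fderiv ℝ (fderiv ℝ Ã) x) x :=
      ((hÃ.fderiv_right (m := 1) le_rfl).differentiable one_ne_zero x).hasFDerivAt
    have hdA₀' : HasFDerivAt (fderiv ℝ A₀) (fderiv ℝ (fderiv ℝ A₀) x) x :=
      ((hA₀.fderiv_right (m := 1) le_rfl).differentiable one_ne_zero x).hasFDerivAt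
    have hcÃ : ∀ y b, HasFDerivAt (fun z => Ã z b) ((fderiv ℝ Ã y).flip b) y := fun y b => by
      simpa using (hdÃ y).clm_apply (hasFDerivAt_const b y)
    have hcA₀ : ∀ y b, HasFDerivAt (fun z => A₀ z b) ((fderiv ℝ A₀ y).flip b) y := fun y b => by
      simpa using (hdA₀ y).clm_apply (hasFDerivAt_const b y)
    -- symmetry of the second derivative of `Ã`
    have hsymm : ∀ i, fderiv ℝ (fderiv ℝ Ã) x (e i) v = fderiv ℝ (fderiv ℝ Ã) x v (e i) := fun i =>
      hÃ.contDiffAt.isSymmSndFDerivAt (by simp [minSmoothness_of_isRCLikeNormedField]) (e i) v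
    -- the function `φ` in terms of the jets
    have happ : ∀ i, (fun z => (Ã z - A₀ z) (e i)) = fun z => Ã z (e i) - A₀ z (e i) := fun i =>
      funext fun z => rfl
    have hφ : (fun y => ∑ i, covDeriv Ã (fun z => (Ã z - A₀ z) (e i)) y (e i)) = fun y => ∑ i,
        (fderiv ℝ Ã y (e i) (e i) - fderiv ℝ A₀ y (e i) (e i) +
          (Ã y (e i) * (Ã y (e i) - A₀ y (e i)) - (Ã y (e i) - A₀ y (e i)) * Ã y (e i))) := by
      funext y
      refine Finset.sum_congr rfl fun i _ => ?_
      have h1 : fderiv ℝ (fun z => (Ã z - A₀ z) (e i)) y (e i) =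
          fderiv ℝ Ã y (e i) (e i) - fderiv ℝ A₀ y (e i) (e i) := by
        rw [happ i, ((hcÃ y (e i)).fun_sub (hcA₀ y (e i))).fderiv]
        simp
      simp only [covDeriv, h1, Ring.lie_def]
      rfl
    -- its value and its derivative at `x`
    have hφx : (∑ i, covDeriv Ã (fun z => (Ã z - A₀ z) (e i)) x (e i)) = ∑ i,
        (fderiv ℝ Ã x (e i) (e i) - fderiv ℝ A₀ x (e i) (e i) +
          (Ã x (e i) * (Ã x (e i) - A₀ x (e i)) - (Ã x (e i) - A₀ x (e i)) * Ã x (e i))) :=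
      congrFun hφ x
    have h2 : ∀ i, HasFDerivAt (fun y => fderiv ℝ Ã y (e i) (e i))
        (((fderiv ℝ (fderiv ℝ Ã) x).flip (e i)).flip (e i)) x := fun i => by
      simpa using ((hdÃ'.clm_apply (hasFDerivAt_const (e i) x)).clm_apply
        (hasFDerivAt_const (e i) x))
    have h3 : ∀ i, HasFDerivAt (fun y => fderiv ℝ A₀ y (e i) (e i))
        (((fderiv ℝ (fderiv ℝ A₀) x).flip (e i)).flip (e i)) x := fun i => by
      simpa using ((hdA₀'.clm_apply (hasFDerivAt_const (e i) x)).clm_apply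
        (hasFDerivAt_const (e i) x))
    have hsum := HasFDerivAt.fun_sum (u := Finset.univ) fun i (_ : i ∈ Finset.univ) =>
      ((h2 i).fun_sub (h3 i)).fun_add (((hcÃ x (e i)).fun_mul'
        ((hcÃ x (e i)).fun_sub (hcA₀ x (e i)))).fun_sub
          (((hcÃ x (e i)).fun_sub (hcA₀ x (e i))).fun_mul' (hcÃ x (e i))))
    have hφ'v : fderiv ℝ (fun y => ∑ i, covDeriv Ã (fun z => (Ã z - A₀ z) (e i)) y (e i)) x v =
        ∑ i, (fderiv ℝ (fderiv ℝ Ã) x v (e i) (e i) - fderiv ℝ (fderiv ℝ A₀) x v (e i) (e i) +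
          (Ã x (e i) * (fderiv ℝ Ã x v (e i) - fderiv ℝ A₀ x v (e i)) +
              fderiv ℝ Ã x v (e i) * (Ã x (e i) - A₀ x (e i)) -
            ((Ã x (e i) - A₀ x (e i)) * fderiv ℝ Ã x v (e i) +
              (fderiv ℝ Ã x v (e i) - fderiv ℝ A₀ x v (e i)) * Ã x (e i)))) := by
      rw [hφ, hsum.fderiv]
      simp only [sum_apply, add_apply, sub_apply, ContinuousLinearMap.flip_apply, smul_apply,
        smul_eq_mul, op_smul_eq_mul]
    -- the covariant divergence, expanded
    have hdiv : divCurvature Ã x v = ∑ i, (fderiv ℝ (fderiv ℝ Ã) x (e i) (e i) v -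
        fderiv ℝ (fderiv ℝ Ã) x (e i) v (e i) +
        (Ã x (e i) * fderiv ℝ Ã x (e i) v + fderiv ℝ Ã x (e i) (e i) * Ã x v -
          (Ã x v * fderiv ℝ Ã x (e i) (e i) + fderiv ℝ Ã x (e i) v * Ã x (e i))) +
        (Ã x (e i) * (fderiv ℝ Ã x (e i) v - fderiv ℝ Ã x v (e i) +
            (Ã x (e i) * Ã x v - Ã x v * Ã x (e i))) -
          (fderiv ℝ Ã x (e i) v - fderiv ℝ Ã x v (e i) +
            (Ã x (e i) * Ã x v - Ã x v * Ã x (e i))) * Ã x (e i))) := by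
      simp only [divCurvature, ← he, covDeriv]
      refine Finset.sum_congr rfl fun i _ => ?_
      rw [fderiv_curvature_apply Ã hÃ x (e i) v (e i),
        curvature_eq_of_differentiableAt Ã (hdÃ x).differentiableAt, Ring.lie_def]
    -- the lower-order terms, expanded
    have hf₀v : f₀ ((A₀ x, fderiv ℝ A₀ x, fderiv ℝ (fderiv ℝ A₀) x), Ã x, fderiv ℝ Ã x) v = ∑ i,
        ((Ã x (e i) * fderiv ℝ Ã x (e i) v - fderiv ℝ Ã x (e i) v * Ã x (e i)) +
          (fderiv ℝ Ã x (e i) (e i) * Ã x v - Ã x v * fderiv ℝ Ã x (e i) (e i)) +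
          (Ã x (e i) * (fderiv ℝ Ã x (e i) v - fderiv ℝ Ã x v (e i) +
              (Ã x (e i) * Ã x v - Ã x v * Ã x (e i))) -
            (fderiv ℝ Ã x (e i) v - fderiv ℝ Ã x v (e i) +
              (Ã x (e i) * Ã x v - Ã x v * Ã x (e i))) * Ã x (e i)) -
          fderiv ℝ (fderiv ℝ A₀) x v (e i) (e i) +
          (A₀ x (e i) * fderiv ℝ Ã x v (e i) - fderiv ℝ Ã x v (e i) * A₀ x (e i)) -
          (Ã x (e i) * fderiv ℝ A₀ x v (e i) - fderiv ℝ A₀ x v (e i) * Ã x (e i)) -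
          ((fderiv ℝ Ã x (e i) (e i) - fderiv ℝ A₀ x (e i) (e i) -
              (Ã x (e i) * A₀ x (e i) - A₀ x (e i) * Ã x (e i))) * Ã x v -
            Ã x v * (fderiv ℝ Ã x (e i) (e i) - fderiv ℝ A₀ x (e i) (e i) -
              (Ã x (e i) * A₀ x (e i) - A₀ x (e i) * Ã x (e i))))) := by
      simp only [hf₀, had, hμ, hev, hev', sum_apply, add_apply, sub_apply,
        ContinuousLinearMap.comp_apply, ContinuousLinearMap.apply_apply,
        ContinuousLinearMap.mul_apply', ContinuousLinearMap.flip_apply]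
    have hlap : (∑ i, fderiv ℝ (fderiv ℝ Ã) x (e i) (e i)) v =
        ∑ i, fderiv ℝ (fderiv ℝ Ã) x (e i) (e i) v := by
      rw [sum_apply]
    -- assemble termwise
    rw [hdiv, covDeriv, hφ'v, hφx, Ring.lie_def, hlap, hf₀v, Finset.mul_sum, Finset.sum_mul]
    simp only [← Finset.sum_sub_distrib, ← Finset.sum_add_distrib]
    refine Finset.sum_congr rfl fun i _ => ?_
    rw [hsymm i]
    noncomm_ring

end DeTurckField


/-! ### Derivatives of maps with values in a closed subspace; periodicity of derivatives -/

section Subspace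

variable {E : Type*} [NormedAddCommGroup E] [NormedSpace ℝ E]
variable {F : Type*} [NormedAddCommGroup F] [NormedSpace ℝ F]

/-- A differentiable map with values in a closed subspace has derivatives in that subspace
(difference quotients lie in the subspace). [folklore] -/
theorem fderiv_mem_of_forall_mem {𝔤 : Submodule ℝ F} (h𝔤 : IsClosed (𝔤 : Set F)) {u : E → F}
    {x : E} (hu : DifferentiableAt ℝ u x) (hmem : ∀ y, u y ∈ 𝔤) (w : E) :
    fderiv ℝ u x w ∈ 𝔤 := by
  have hlim := hu.hasFDerivAt.lim w (c := fun n : ℕ => (n : ℝ)) (l := atTop)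
    (by simpa using tendsto_natCast_atTop_atTop)
  refine h𝔤.mem_of_tendsto hlim (Eventually.of_forall fun n => ?_)
  exact 𝔤.smul_mem _ (𝔤.sub_mem (hmem _) (hmem _))

/-- If the derivative is junk (the map is not differentiable at `x`) the conclusion of
`fderiv_mem_of_forall_mem` holds trivially; combined form. [folklore] -/
theorem fderiv_mem_of_forall_mem' {𝔤 : Submodule ℝ F} (h𝔤 : IsClosed (𝔤 : Set F)) {u : E → F}
    (hmem : ∀ y, u y ∈ 𝔤) (x w : E) : fderiv ℝ u x w ∈ 𝔤 := by
  by_cases hu : DifferentiableAt ℝ u x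
  · exact fderiv_mem_of_forall_mem h𝔤 hu hmem w
  · rw [fderiv_zero_of_not_differentiableAt hu]
    exact 𝔤.zero_mem

/-- Derivatives of a map invariant under a translation are invariant under it. [folklore] -/
theorem fderiv_comp_add_eq_of_forall {u : E → F} {w : E} (hper : ∀ y, u (y + w) = u y) (x : E) :
    fderiv ℝ u (x + w) = fderiv ℝ u x := by
  rw [← fderiv_comp_add_right w]
  exact congrArg (fun g => fderiv ℝ g x) (funext fun z => hper z)

end Subspace

/-! ### The DeTurck gauge-fixing function `φ(Ã) = −D_Ã^*(Ã − A₀)` along a time-dependent connection -/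

section DeTurckPhi

variable {E : Type*} [NormedAddCommGroup E] [InnerProductSpace ℝ E]
variable {𝔸 : Type*} [NormedRing 𝔸] [NormedAlgebra ℝ 𝔸]

/-- Pointwise formula for `φ(Ã)(y) = Σᵢ D_{eᵢ}((Ã − A₀)(eᵢ))(y)` in terms of the 1-jets of `Ã` and
`A₀` at `y` (both differentiable at `y`). [folklore] -/
theorem deTurckPhi_eq {ι : Type*} [Fintype ι] (b : ι → E) {Ã A₀ : Connection E 𝔸} {y : E}
    (hÃ : DifferentiableAt ℝ Ã y) (hA₀ : DifferentiableAt ℝ A₀ y) :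
    (∑ i, covDeriv Ã (fun z => (Ã z - A₀ z) (b i)) y (b i)) = ∑ i,
      (fderiv ℝ Ã y (b i) (b i) - fderiv ℝ A₀ y (b i) (b i) +
        (Ã y (b i) * (Ã y (b i) - A₀ y (b i)) - (Ã y (b i) - A₀ y (b i)) * Ã y (b i))) := by
  refine Finset.sum_congr rfl fun i _ => ?_
  have hc : ∀ (B : Connection E 𝔸), DifferentiableAt ℝ B y → ∀ c,
      HasFDerivAt (fun z => B z c) ((fderiv ℝ B y).flip c) y := fun B hB c => by
    simpa using hB.hasFDerivAt.clm_apply (hasFDerivAt_const c y)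
  have happ : (fun z => (Ã z - A₀ z) (b i)) = fun z => Ã z (b i) - A₀ z (b i) :=
    funext fun z => rfl
  have h1 : fderiv ℝ (fun z => (Ã z - A₀ z) (b i)) y (b i) =
      fderiv ℝ Ã y (b i) (b i) - fderiv ℝ A₀ y (b i) (b i) := by
    rw [happ, ((hc Ã hÃ (b i)).fun_sub (hc A₀ hA₀ (b i))).fderiv]
    simp
  simp only [covDeriv, h1, Ring.lie_def]
  rfl

/-- **Joint smoothness of `φ`.** Along a time-dependent connection `Ã` jointly `C^∞` on `S × E`
(`S` a set of unique differentiability) and for a `C^∞` reference connection `A₀`, the DeTurck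
function `(t, y) ↦ φ(Ã(t))(y) = Σᵢ D_{eᵢ}((Ã(t) − A₀)(eᵢ))(y)` is jointly `C^∞` on `S × E`.
[folklore] -/
theorem contDiffOn_deTurckPhi {ι : Type*} [Fintype ι] (b : ι → E) {Ã : ℝ → Connection E 𝔸}
    {A₀ : Connection E 𝔸} {S : Set ℝ} (hS : UniqueDiffOn ℝ S)
    (hÃ : ContDiffOn ℝ ∞ (fun p : ℝ × E => Ã p.1 p.2) (S ×ˢ (univ : Set E)))
    (hA₀ : ContDiff ℝ ∞ A₀) :
    ContDiffOn ℝ ∞ (fun p : ℝ × E => ∑ i, covDeriv (Ã p.1) (fun z => (Ã p.1 z - A₀ z) (b i)) p.2 (b i))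
      (S ×ˢ (univ : Set E)) := by
  have hA₀' : ContDiff ℝ ∞ (fderiv ℝ A₀) := hA₀.fderiv_right (by simp)
  have hslice : ∀ t ∈ S, ContDiff ℝ ∞ (Ã t) := fun t ht => contDiff_slice_of_contDiffOn_prod hÃ ht
  -- the 1-jet of `Ã` is jointly smooth (in the `ℝ × E` convention)
  have hJ : ContDiffOn ℝ ∞ (fun p : ℝ × E => fderiv ℝ (Ã p.1) p.2) (S ×ˢ (univ : Set E)) := by
    have h := contDiffOn_fderiv_tslice hS (contDiffOn_swap_iff.2 hÃ)
    have hcomp : (fun p : ℝ × E => fderiv ℝ (Ã p.1) p.2) =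
        (fun q : E × ℝ => fderiv ℝ (Ã q.2) q.1) ∘ Prod.swap := rfl
    rw [hcomp]
    exact h.comp (ContinuousLinearEquiv.prodComm ℝ ℝ E).contDiff.contDiffOn
      fun p hp => ⟨mem_univ _, hp.1⟩
  have heq : EqOn (fun p : ℝ × E => ∑ i, covDeriv (Ã p.1) (fun z => (Ã p.1 z - A₀ z) (b i)) p.2 (b i))
      (fun p : ℝ × E => ∑ i, (fderiv ℝ (Ã p.1) p.2 (b i) (b i) - fderiv ℝ A₀ p.2 (b i) (b i) +
        (Ã p.1 p.2 (b i) * (Ã p.1 p.2 (b i) - A₀ p.2 (b i)) -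
          (Ã p.1 p.2 (b i) - A₀ p.2 (b i)) * Ã p.1 p.2 (b i)))) (S ×ˢ (univ : Set E)) := by
    rintro ⟨t, y⟩ ⟨ht, -⟩
    exact deTurckPhi_eq b ((hslice t ht).differentiable (by simp) y)
      (hA₀.differentiable (by simp) y)
  refine ContDiffOn.congr ?_ heq
  refine ContDiffOn.sum fun i _ => ?_
  have hÃi : ContDiffOn ℝ ∞ (fun p : ℝ × E => Ã p.1 p.2 (b i)) (S ×ˢ (univ : Set E)) :=
    hÃ.clm_apply contDiffOn_const
  have hA₀i : ContDiffOn ℝ ∞ (fun p : ℝ × E => A₀ p.2 (b i)) (S ×ˢ (univ : Set E)) :=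
    ((hA₀.comp contDiff_snd).contDiffOn).clm_apply contDiffOn_const
  have hJi : ContDiffOn ℝ ∞ (fun p : ℝ × E => fderiv ℝ (Ã p.1) p.2 (b i) (b i)) (S ×ˢ (univ : Set E)) :=
    (hJ.clm_apply contDiffOn_const).clm_apply contDiffOn_const
  have hA₀'i : ContDiffOn ℝ ∞ (fun p : ℝ × E => fderiv ℝ A₀ p.2 (b i) (b i)) (S ×ˢ (univ : Set E)) :=
    (((hA₀'.comp contDiff_snd).contDiffOn).clm_apply contDiffOn_const).clm_apply contDiffOn_const
  exact (hJi.sub hA₀'i).add ((hÃi.mul (hÃi.sub hA₀i)).sub ((hÃi.sub hA₀i).mul hÃi))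

/-- **Periodicity of `φ`.** If `Ã` and `A₀` are invariant under translation by `w` then so is
`φ(Ã) = Σᵢ D_{eᵢ}((Ã − A₀)(eᵢ))`. [folklore] -/
theorem deTurckPhi_comp_add {ι : Type*} [Fintype ι] (b : ι → E) {Ã A₀ : Connection E 𝔸} {w : E}
    (hÃ : ∀ y, Ã (y + w) = Ã y) (hA₀ : ∀ y, A₀ (y + w) = A₀ y) (y : E) :
    (∑ i, covDeriv Ã (fun z => (Ã z - A₀ z) (b i)) (y + w) (b i)) =
      ∑ i, covDeriv Ã (fun z => (Ã z - A₀ z) (b i)) y (b i) := by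
  refine Finset.sum_congr rfl fun i _ => ?_
  have hper : ∀ z, (Ã (z + w) - A₀ (z + w)) (b i) = (Ã z - A₀ z) (b i) := by
    intro z
    rw [hÃ z, hA₀ z]
  have hd := fderiv_comp_add_eq_of_forall (u := fun z => (Ã z - A₀ z) (b i)) hper y
  simp only [covDeriv, hd, hÃ y, hA₀ y]

/-- **Values of `φ`.** If `Ã` and `A₀` take values in a closed subspace `𝔤 ⊆ 𝔸` which is closed
under commutators, then `φ(Ã) = Σᵢ D_{eᵢ}((Ã − A₀)(eᵢ))` is `𝔤`-valued. [folklore] -/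
theorem deTurckPhi_mem {ι : Type*} [Fintype ι] (b : ι → E) {𝔤 : Submodule ℝ 𝔸}
    (h𝔤 : IsClosed (𝔤 : Set 𝔸)) (h𝔤b : ∀ a c : 𝔸, a ∈ 𝔤 → c ∈ 𝔤 → a * c - c * a ∈ 𝔤)
    {Ã A₀ : Connection E 𝔸} (hÃ : Ã.IsValuedIn 𝔤) (hA₀ : A₀.IsValuedIn 𝔤) (y : E) :
    (∑ i, covDeriv Ã (fun z => (Ã z - A₀ z) (b i)) y (b i)) ∈ 𝔤 := by
  refine Submodule.sum_mem _ fun i _ => ?_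
  simp only [covDeriv, Ring.lie_def]
  refine 𝔤.add_mem (fderiv_mem_of_forall_mem' h𝔤 (fun z => ?_) y (b i)) (h𝔤b _ _ (hÃ y (b i)) ?_)
  · exact 𝔤.sub_mem (hÃ z (b i)) (hA₀ z (b i))
  · exact 𝔤.sub_mem (hÃ y (b i)) (hA₀ y (b i))

end DeTurckPhi


/-! ### Consequences of the gauge ODE: periodicity -/

section GaugeODEConsequences

variable {E : Type*} [NormedAddCommGroup E]
variable {𝔸 : Type*} [NormedRing 𝔸] [NormedAlgebra ℝ 𝔸]

/-- **Translation invariance passes through the gauge ODE.** If `∂ₜ g = g φ` on `[0, ε') × E`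
with `g(0, ·) = 1`, `g` jointly continuous on `(-ε', ε') × E`, and `φ(t, ·)` is invariant under
translation by `w` for `t ∈ [0, ε')` (and continuous in `t`), then so is `g(t, ·)` for
`t ∈ [0, ε')` (one-sided uniqueness, `eqOn_of_gauge_ode`). [folklore] -/
theorem gauge_comp_add_of_ode {ε' : ℝ} {g : ℝ → E → 𝔸ˣ} {φ : ℝ → E → 𝔸} {w : E}
    (hg0 : ∀ x, g 0 x = 1)
    (hgc : ContinuousOn (fun p : ℝ × E => (g p.1 p.2 : 𝔸)) (Ioo (-ε') ε' ×ˢ (univ : Set E)))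
    (hφc : ContinuousOn (fun p : ℝ × E => φ p.1 p.2) (Ico 0 ε' ×ˢ (univ : Set E)))
    (hode : ∀ t ∈ Ico 0 ε', ∀ x : E, HasDerivAt (fun s => (g s x : 𝔸)) ((g t x : 𝔸) * φ t x) t)
    (hφ : ∀ t ∈ Ico 0 ε', ∀ y, φ t (y + w) = φ t y) {t : ℝ} (ht : t ∈ Ico 0 ε') (x : E) :
    g t (x + w) = g t x := by
  rcases eq_or_lt_of_le ht.1 with h0 | h0
  · rw [← h0, hg0, hg0]
  -- uniqueness on `[0, t]`
  have hsub : Icc 0 t ⊆ Ico 0 ε' := fun s hs => ⟨hs.1, hs.2.trans_lt ht.2⟩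
  have hcg : ∀ y : E, ContinuousOn (fun s => (g s y : 𝔸)) (Icc 0 t) := fun y => by
    have h1 : ContinuousOn (fun s : ℝ => ((s, y) : ℝ × E)) (Icc 0 t) :=
      (continuous_id.prodMk continuous_const).continuousOn
    exact hgc.comp h1 fun s hs => ⟨⟨by linarith [hs.1, ht.2], hs.2.trans_lt ht.2⟩, mem_univ y⟩
  have hcφ : ContinuousOn (fun s => φ s x) (Icc 0 t) := by
    have h1 : ContinuousOn (fun s : ℝ => ((s, x) : ℝ × E)) (Icc 0 t) :=
      (continuous_id.prodMk continuous_const).continuousOn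
    exact hφc.comp h1 fun s hs => ⟨hsub hs, mem_univ x⟩
  have key := eqOn_of_gauge_ode (ψ := fun s => φ s x) hcφ (hcg (x + w)) (hcg x)
    (fun s hs => by
      have h := hode s ⟨hs.1, hs.2.trans ht.2⟩ (x + w)
      rw [hφ s ⟨hs.1, hs.2.trans ht.2⟩ x] at h
      exact h)
    (fun s hs => hode s ⟨hs.1, hs.2.trans ht.2⟩ x) (by simp [hg0])
  exact Units.ext (key ⟨ht.1, le_rfl⟩)

end GaugeODEConsequences

/-! ### Star-algebra coefficients: skew-adjoint values, unitarity along the gauge ODE -/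

section StarCalculus

variable {𝔸 : Type*} [NormedRing 𝔸] [NormedAlgebra ℝ 𝔸] [StarRing 𝔸] [StarModule ℝ 𝔸]

/-- The skew-adjoint elements (`𝔲(N)` for `𝔸 = M_N(ℂ)`) are closed under commutators. [folklore] -/
theorem skewAdjoint_comm_mem {a b : 𝔸} (ha : a ∈ skewAdjoint.submodule ℝ 𝔸)
    (hb : b ∈ skewAdjoint.submodule ℝ 𝔸) : a * b - b * a ∈ skewAdjoint.submodule ℝ 𝔸 := by
  have ha' : star a = -a := skewAdjoint.mem_iff.mp ha
  have hb' : star b = -b := skewAdjoint.mem_iff.mp hb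
  refine skewAdjoint.mem_iff.mpr ?_
  rw [star_sub, star_mul, star_mul, ha', hb']
  noncomm_ring

variable [FiniteDimensional ℝ 𝔸]

/-- Time derivative of the adjoint: `∂ₜ (G⋆) = (∂ₜ G)⋆` (the star is a continuous `ℝ`-linear map
of the finite-dimensional algebra `𝔸`). [folklore] -/
theorem hasDerivAt_star_comp {G : ℝ → 𝔸} {G' : 𝔸} {t : ℝ} (h : HasDerivAt G G' t) :
    HasDerivAt (fun s => star (G s)) (star G') t := by
  let L : 𝔸 →ₗ[ℝ] 𝔸 :=
    { toFun := fun M => star M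
      map_add' := fun M M' => star_add M M'
      map_smul' := fun c M => by rw [star_smul, star_trivial]; rfl }
  have hL := (LinearMap.toContinuousLinearMap L).hasFDerivAt (x := G t)
  exact hL.comp_hasDerivAt t h

/-- Space derivative of the adjoint of a differentiable field: `∂_w (G⋆) = (∂_w G)⋆`. [folklore] -/
theorem fderiv_star_comp_apply {X : Type*} [NormedAddCommGroup X] [NormedSpace ℝ X] {G : X → 𝔸}
    {x : X} (hG : DifferentiableAt ℝ G x) :
    DifferentiableAt ℝ (fun y => star (G y)) x ∧
      ∀ w, fderiv ℝ (fun y => star (G y)) x w = star (fderiv ℝ G x w) := by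
  let L : 𝔸 →ₗ[ℝ] 𝔸 :=
    { toFun := fun M => star M
      map_add' := fun M M' => star_add M M'
      map_smul' := fun c M => by rw [star_smul, star_trivial]; rfl }
  have hL := (LinearMap.toContinuousLinearMap L).hasFDerivAt (x := G x)
  have h : HasFDerivAt (fun y => star (G y)) ((LinearMap.toContinuousLinearMap L).comp (fderiv ℝ G x)) x :=
    hL.comp x hG.hasFDerivAt
  refine ⟨h.differentiableAt, fun w => ?_⟩
  rw [h.fderiv]
  rfl

/-- **Unitarity along the gauge ODE.** If `∂ₜ G = G ψ` on `[0, b)` with `ψ(t)` skew-adjoint and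
`G(0) = 1`, then `G(t) G(t)⋆ = 1` on `[0, b)` (the derivative of `G G⋆` is
`G (ψ + ψ⋆) G⋆ = 0`). [folklore] -/
theorem mul_star_eq_one_of_ode {b : ℝ} {G ψ : ℝ → 𝔸}
    (hG : ∀ t ∈ Ico 0 b, HasDerivAt G (G t * ψ t) t)
    (hψ : ∀ t ∈ Ico 0 b, ψ t ∈ skewAdjoint.submodule ℝ 𝔸)
    (h0 : G 0 = 1) {t : ℝ} (ht : t ∈ Ico 0 b) : G t * star (G t) = 1 := by
  have hd : ∀ s ∈ Ico 0 b, HasDerivAt (fun s => G s * star (G s)) 0 s := by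
    intro s hs
    have h := (hG s hs).mul (hasDerivAt_star_comp (hG s hs))
    refine h.congr_deriv ?_
    have hψ' : star (ψ s) = -ψ s := skewAdjoint.mem_iff.mp (hψ s hs)
    rw [star_mul, hψ']
    noncomm_ring
  have hcont : ContinuousOn (fun s => G s * star (G s)) (Icc 0 t) := fun s hs =>
    (hd s ⟨hs.1, hs.2.trans_lt ht.2⟩).continuousAt.continuousWithinAt
  have key := constant_of_has_deriv_right_zero hcont
    (fun s hs => (hd s ⟨hs.1, hs.2.trans ht.2⟩).hasDerivWithinAt) t ⟨ht.1, le_rfl⟩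
  rw [key, h0]
  simp

end StarCalculus


/-! ### Short-time existence from semilinear parabolic theory (the DeTurck trick, assembled) -/

section ShortTime

variable {𝔸 : Type} [NormedRing 𝔸] [NormedAlgebra ℝ 𝔸] [CompleteSpace 𝔸] [FiniteDimensional ℝ 𝔸]
  [StarRing 𝔸] [StarModule ℝ 𝔸]

set_option maxHeartbeats 800000 in
/-- **Short-time existence of classical solutions of the Yang–Mills heat flow on the flat torus,
from local existence for semilinear heat systems (the DeTurck trick, Donaldson–Kronheimer §6.3.1;
Struwe 1994, §4.1).** Coefficients: a finite-dimensional complete real normed star algebra `𝔸`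
with its skew-adjoint part `𝔲 = {a | a⋆ = −a}` as structure Lie algebra (`𝔸 = M_N(ℂ)`,
`𝔲 = 𝔲(N)`). ASSUME `hSL`, local well-posedness of semilinear parabolic systems with the flat
Laplacian as principal part on the flat torus `ℝ⁴/Lℤ⁴`, in the periodic formulation and for
smooth data (Taylor, *PDE III*, Ch. 15, §1): for every subspace `𝔤 ⊆ 𝔸` and every smooth
nonlinearity `f(x, u, ∂u)` which is `L`-periodic in `x` and maps `𝔤`-valued 1-jets to `𝔤`-valued
forms, every smooth `L`-periodic `𝔤`-valued `u₀ : ℝ⁴ → (ℝ⁴ →L 𝔸)` is the initial value of a map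
`u`, jointly smooth on `[0, ε) × ℝ⁴` for some `ε > 0`, `L`-periodic and `𝔤`-valued, with
`∂ₜ u = Σᵢ ∂ᵢ∂ᵢ u + f(x, u, ∂u)` on `(0, ε)` (`eᵢ` the standard orthonormal frame). THEN every
smooth `L`-periodic `𝔲`-valued connection `A₀` on `ℝ⁴` launches a classical solution of the
Yang–Mills heat flow `∂ₜ A_v = Σ_μ D_μ F_{μ v}` on some `[0, ε') × ℝ⁴`, jointly smooth, periodic
and `𝔲`-valued (hypothesis `hST` of
`Waldron2019_yangMillsFlow_flatTorus_of_shortTime_of_smoothExtension`). PROOF (all steps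
formal): the modified flow `∂ₜ Ã = div_Ã F_Ã + D_Ã φ(Ã)`, `φ(Ã) = −D_Ã^*(Ã − A₀)`, is such a
semilinear heat system (`exists_contDiff_deTurck_eq`; `𝔲` is closed under commutators), so `hSL`
solves it from `A₀`; the gauge ODE `∂ₜ g = g φ(Ã)`, `g(0) = 1` has a jointly smooth solution
(`exists_gauge_of_ode`), `L`-periodic (`gauge_comp_add_of_ode`) and unitary
(`mul_star_eq_one_of_ode`, as `φ` is `𝔲`-valued); and `A = g • Ã` is jointly smooth, periodic,
`𝔲`-valued, starts at `A₀` (`g(0) = 1`, `dg(0) = 0`) and solves the Yang–Mills heat flow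
(`deriv_gaugeAct_tslice_eq_divCurvature`). [cite: DonaldsonKronheimer1990, §6.3.1]
[cite: Struwe1994, §4.1, (16)–(18)] [cite: TaylorPDEIII2011, Ch. 15, §1] -/
theorem shortTime_of_semilinearHeat
    (hSL : ∀ (𝔤 : Submodule ℝ 𝔸) (L : ℝ), 0 < L →
      ∀ f : EuclideanSpace ℝ (Fin 4) × (EuclideanSpace ℝ (Fin 4) →L[ℝ] 𝔸) ×
          (EuclideanSpace ℝ (Fin 4) →L[ℝ] EuclideanSpace ℝ (Fin 4) →L[ℝ] 𝔸) →
          (EuclideanSpace ℝ (Fin 4) →L[ℝ] 𝔸),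
        ContDiff ℝ ∞ f →
        (∀ (x : EuclideanSpace ℝ (Fin 4)) (i : Fin 4) (a : EuclideanSpace ℝ (Fin 4) →L[ℝ] 𝔸)
            (p : EuclideanSpace ℝ (Fin 4) →L[ℝ] EuclideanSpace ℝ (Fin 4) →L[ℝ] 𝔸),
          f (x + EuclideanSpace.single i L, a, p) = f (x, a, p)) →
        (∀ (x : EuclideanSpace ℝ (Fin 4)) (a : EuclideanSpace ℝ (Fin 4) →L[ℝ] 𝔸)
            (p : EuclideanSpace ℝ (Fin 4) →L[ℝ] EuclideanSpace ℝ (Fin 4) →L[ℝ] 𝔸),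
          (∀ v, a v ∈ 𝔤) → (∀ u v, p u v ∈ 𝔤) → ∀ v, f (x, a, p) v ∈ 𝔤) →
        ∀ u₀ : Connection (EuclideanSpace ℝ (Fin 4)) 𝔸, IsSmoothConnection u₀ →
          u₀.IsValuedIn 𝔤 → u₀.IsLatticePeriodic L →
          ∃ ε : ℝ, 0 < ε ∧ ∃ u : ℝ → Connection (EuclideanSpace ℝ (Fin 4)) 𝔸,
            u 0 = u₀ ∧
            ContDiffOn ℝ ∞ (fun p : ℝ × EuclideanSpace ℝ (Fin 4) => u p.1 p.2) (Ico 0 ε ×ˢ univ) ∧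
            (∀ t : ℝ, 0 ≤ t → t < ε → (u t).IsLatticePeriodic L) ∧
            (∀ t : ℝ, 0 ≤ t → t < ε → (u t).IsValuedIn 𝔤) ∧
            ∀ t : ℝ, 0 < t → t < ε → ∀ x v : EuclideanSpace ℝ (Fin 4),
              deriv (fun s => u s x v) t =
                (∑ i, fderiv ℝ (fderiv ℝ (u t)) x (stdOrthonormalBasis ℝ (EuclideanSpace ℝ (Fin 4)) i)
                  (stdOrthonormalBasis ℝ (EuclideanSpace ℝ (Fin 4)) i)) v +
                f (x, u t x, fderiv ℝ (u t) x) v)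
    (L : ℝ) (hL : 0 < L) (A₀ : Connection (EuclideanSpace ℝ (Fin 4)) 𝔸)
    (hs : IsSmoothConnection A₀) (hv : A₀.IsValuedIn (skewAdjoint.submodule ℝ 𝔸))
    (hp : A₀.IsLatticePeriodic L) :
    ∃ ε : ℝ, 0 < ε ∧ ∃ A : ℝ → Connection (EuclideanSpace ℝ (Fin 4)) 𝔸,
      A 0 = A₀ ∧
      ContDiffOn ℝ ∞ (fun p : ℝ × EuclideanSpace ℝ (Fin 4) => A p.1 p.2) (Ico 0 ε ×ˢ univ) ∧
      (∀ t : ℝ, 0 ≤ t → t < ε → (A t).IsLatticePeriodic L) ∧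
      (∀ t : ℝ, 0 < t → t < ε → (A t).IsValuedIn (skewAdjoint.submodule ℝ 𝔸)) ∧
      ∀ t : ℝ, 0 < t → t < ε → ∀ x v : EuclideanSpace ℝ (Fin 4),
        deriv (fun s => A s x v) t = divCurvature (A t) x v := by
  -- notation
  set 𝔲 : Submodule ℝ 𝔸 := skewAdjoint.submodule ℝ 𝔸 with h𝔲def
  set e := stdOrthonormalBasis ℝ (EuclideanSpace ℝ (Fin 4)) with he
  have h𝔲c : IsClosed (𝔲 : Set 𝔸) := 𝔲.closed_of_finiteDimensional
  have hcomm : ∀ a b : 𝔸, a ∈ 𝔲 → b ∈ 𝔲 → a * b - b * a ∈ 𝔲 :=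
    fun a b ha hb => skewAdjoint_comm_mem ha hb
  have hA₀ : ContDiff ℝ ∞ A₀ := hs
  have hA₀' : ContDiff ℝ ∞ (fderiv ℝ A₀) := hA₀.fderiv_right (by simp)
  have hA₀'' : ContDiff ℝ ∞ (fderiv ℝ (fderiv ℝ A₀)) := hA₀'.fderiv_right (by simp)
  have hA₀2 : ContDiff ℝ 2 A₀ := hA₀.of_le (WithTop.coe_le_coe.mpr le_top)
  -- the jets of `A₀` are `𝔲`-valued and periodic
  have hb' : ∀ x u w, fderiv ℝ A₀ x u w ∈ 𝔲 := by
    intro x u w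
    rw [← fderiv_connection_apply A₀ (hA₀.differentiable (by simp) x) u w]
    exact fderiv_mem_of_forall_mem' h𝔲c (fun y => hv y w) x u
  have hb'' : ∀ x u w₁ w₂, fderiv ℝ (fderiv ℝ A₀) x u w₁ w₂ ∈ 𝔲 := by
    intro x u w₁ w₂
    have hd' : HasFDerivAt (fderiv ℝ A₀) (fderiv ℝ (fderiv ℝ A₀) x) x :=
      (hA₀'.differentiable (by simp) x).hasFDerivAt
    have h2 : HasFDerivAt (fun y => fderiv ℝ A₀ y w₁ w₂)
        (((fderiv ℝ (fderiv ℝ A₀) x).flip w₁).flip w₂) x := by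
      simpa using ((hd'.clm_apply (hasFDerivAt_const w₁ x)).clm_apply (hasFDerivAt_const w₂ x))
    have key : fderiv ℝ (fun y => fderiv ℝ A₀ y w₁ w₂) x u ∈ 𝔲 :=
      fderiv_mem_of_forall_mem' h𝔲c (fun y => hb' y w₁ w₂) x u
    rw [h2.fderiv] at key
    simpa using key
  have hper1 : ∀ (x : EuclideanSpace ℝ (Fin 4)) (i : Fin 4),
      fderiv ℝ A₀ (x + EuclideanSpace.single i L) = fderiv ℝ A₀ x := fun x i =>
    fderiv_comp_add_eq_of_forall (u := A₀) (fun y => hp y i) x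
  have hper2 : ∀ (x : EuclideanSpace ℝ (Fin 4)) (i : Fin 4),
      fderiv ℝ (fderiv ℝ A₀) (x + EuclideanSpace.single i L) = fderiv ℝ (fderiv ℝ A₀) x :=
    fun x i => fderiv_comp_add_eq_of_forall (u := fderiv ℝ A₀) (fun y => hper1 y i) x
  -- the DeTurck vector field and the modified flow, solved by `hSL`
  obtain ⟨f₀, hf₀s, hf₀g, hf₀eq⟩ :=
    exists_contDiff_deTurck_eq (E := EuclideanSpace ℝ (Fin 4)) (𝔸 := 𝔸)
  have hJ : ContDiff ℝ ∞ fun y : EuclideanSpace ℝ (Fin 4) =>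
      (A₀ y, fderiv ℝ A₀ y, fderiv ℝ (fderiv ℝ A₀) y) := hA₀.prodMk (hA₀'.prodMk hA₀'')
  obtain ⟨ε, hε, Ã, hÃ0, hÃs, hÃp, hÃv, hÃpde⟩ := hSL 𝔲 L hL
    (fun q => f₀ ((A₀ q.1, fderiv ℝ A₀ q.1, fderiv ℝ (fderiv ℝ A₀) q.1), q.2.1, q.2.2))
    (hf₀s.comp ((hJ.comp contDiff_fst).prodMk (contDiff_snd.fst.prodMk contDiff_snd.snd)))
    (fun x i a p => by simp only [hp x i, hper1 x i, hper2 x i])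
    (fun x a p ha hpa v => hf₀g 𝔲 hcomm _ (hv x) (hb' x) (hb'' x) ha hpa v)
    A₀ hs hv hp
  -- the DeTurck function `φ = −D_Ã^*(Ã − A₀)` along the modified flow
  set φ : ℝ → EuclideanSpace ℝ (Fin 4) → 𝔸 := fun t y =>
    ∑ i, covDeriv (Ã t) (fun z => (Ã t z - A₀ z) (e i)) y (e i) with hφdef
  have hφs : ContDiffOn ℝ ∞ (fun p : ℝ × EuclideanSpace ℝ (Fin 4) => φ p.1 p.2) (Ico 0 ε ×ˢ univ) :=
    contDiffOn_deTurckPhi (fun i => e i) (uniqueDiffOn_Ico 0 ε) hÃs hA₀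
  have hφp : ∀ t ∈ Ico (0 : ℝ) ε, ∀ (y : EuclideanSpace ℝ (Fin 4)) (i : Fin 4),
      φ t (y + EuclideanSpace.single i L) = φ t y := fun t ht y i =>
    deTurckPhi_comp_add (fun i => e i) (fun z => hÃp t ht.1 ht.2 z i) (fun z => hp z i) y
  have hφv : ∀ t ∈ Ico (0 : ℝ) ε, ∀ y, φ t y ∈ 𝔲 := fun t ht y =>
    deTurckPhi_mem (fun i => e i) h𝔲c hcomm (hÃv t ht.1 ht.2) hv y
  -- the gauge transformation `∂ₜ g = g φ`, `g(0) = 1`, on `[0, ε/2)`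
  have hε2 : 0 < ε / 2 := by positivity
  have hε2' : ε / 2 < ε := by linarith
  obtain ⟨g, hg0, hgs, hgis, hgd, -⟩ :=
    exists_gauge_of_ode (E := EuclideanSpace ℝ (Fin 4)) (𝔸 := 𝔸) hε hφs hε2 hε2'
  -- `g` is periodic
  have hgper : ∀ t ∈ Ico (0 : ℝ) (ε / 2), ∀ (x : EuclideanSpace ℝ (Fin 4)) (i : Fin 4),
      g t (x + EuclideanSpace.single i L) = g t x := by
    intro t ht x i
    exact gauge_comp_add_of_ode (φ := φ) hg0 hgs.continuousOn
      (hφs.continuousOn.mono (prod_mono (Ico_subset_Ico_right hε2'.le) le_rfl)) hgd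
      (fun s hs y => hφp s ⟨hs.1, hs.2.trans hε2'⟩ y i) ht x
  -- `g` is unitary: `g g⋆ = 1`, so `g⋆ = g⁻¹`
  have hgunit : ∀ t ∈ Ico (0 : ℝ) (ε / 2), ∀ x : EuclideanSpace ℝ (Fin 4),
      (g t x : 𝔸) * star (g t x : 𝔸) = 1 := fun t ht x =>
    mul_star_eq_one_of_ode (G := fun s => (g s x : 𝔸)) (ψ := fun s => φ s x)
      (fun s hs => hgd s hs x) (fun s hs => hφv s ⟨hs.1, hs.2.trans hε2'⟩ x)
      (by simp [hg0 x]) ht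
  have hgstar : ∀ t ∈ Ico (0 : ℝ) (ε / 2), ∀ x : EuclideanSpace ℝ (Fin 4),
      star (g t x : 𝔸) = (((g t x)⁻¹ : 𝔸ˣ) : 𝔸) := by
    intro t ht x
    have h := hgunit t ht x
    calc star (g t x : 𝔸) = (((g t x)⁻¹ : 𝔸ˣ) : 𝔸) * ((g t x : 𝔸) * star (g t x : 𝔸)) := by
          rw [← mul_assoc, Units.inv_mul, one_mul]
      _ = (((g t x)⁻¹ : 𝔸ˣ) : 𝔸) := by rw [h, mul_one]
  -- the gauge transform of the modified flow
  set A : ℝ → Connection (EuclideanSpace ℝ (Fin 4)) 𝔸 := fun t => gaugeAct (g t) (Ã t) with hAdef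
  have hsub1 : Ico (0 : ℝ) (ε / 2) ×ˢ (univ : Set (EuclideanSpace ℝ (Fin 4))) ⊆
      Ioo (-(ε / 2)) (ε / 2) ×ˢ univ :=
    prod_mono (fun t ht => ⟨by linarith [ht.1], ht.2⟩) le_rfl
  have hsub2 : Ico (0 : ℝ) (ε / 2) ×ˢ (univ : Set (EuclideanSpace ℝ (Fin 4))) ⊆ Ico 0 ε ×ˢ univ :=
    prod_mono (Ico_subset_Ico_right hε2'.le) le_rfl
  refine ⟨ε / 2, hε2, A, ?_, ?_, ?_, ?_, ?_⟩
  · -- initial value: `g(0) = 1`, `dg(0) = 0`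
    have hg0' : (fun y : EuclideanSpace ℝ (Fin 4) => (g 0 y : 𝔸)) = fun _ => 1 := by
      funext y
      rw [hg0 y]
      rfl
    funext x
    ext v
    simp only [hAdef, gaugeAct_apply, hg0', hÃ0, hg0 x]
    simp
  · -- joint smoothness of `g • Ã`
    have hDg : ContDiffOn ℝ ∞ (fun p : ℝ × EuclideanSpace ℝ (Fin 4) =>
        fderiv ℝ (fun y => (g p.1 y : 𝔸)) p.2) (Ioo (-(ε / 2)) (ε / 2) ×ˢ univ) := by
      have hsw : ContDiffOn ℝ ∞ (fun q : EuclideanSpace ℝ (Fin 4) × ℝ => (g q.2 q.1 : 𝔸))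
          (univ ×ˢ Ioo (-(ε / 2)) (ε / 2)) := by
        refine hgs.comp (contDiffOn_snd.prodMk contDiffOn_fst) ?_
        rintro ⟨y, t⟩ ⟨-, ht⟩
        exact ⟨ht, mem_univ y⟩
      have h := Literature.Geometry.Lorentzian.MetricCoord.contDiffOn_fderiv_slice isOpen_univ
        (uniqueDiffOn_Ioo (-(ε / 2)) (ε / 2)) hsw
      have h' := h.comp (contDiffOn_snd.prodMk contDiffOn_fst)
        (s := Ioo (-(ε / 2)) (ε / 2) ×ˢ (univ : Set (EuclideanSpace ℝ (Fin 4))))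
        (by rintro ⟨t, y⟩ ⟨ht, -⟩; exact ⟨mem_univ y, ht⟩)
      exact h'
    have hml : ContDiffOn ℝ ∞ (fun p : ℝ × EuclideanSpace ℝ (Fin 4) =>
        ContinuousLinearMap.mulLeftRight ℝ 𝔸 (g p.1 p.2 : 𝔸) (((g p.1 p.2)⁻¹ : 𝔸ˣ) : 𝔸))
        (Ioo (-(ε / 2)) (ε / 2) ×ˢ univ) :=
      ((ContinuousLinearMap.mulLeftRight ℝ 𝔸).contDiff.comp_contDiffOn hgs).clm_apply hgis
    have hml1 : ContDiffOn ℝ ∞ (fun p : ℝ × EuclideanSpace ℝ (Fin 4) =>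
        ContinuousLinearMap.mulLeftRight ℝ 𝔸 (1 : 𝔸) (((g p.1 p.2)⁻¹ : 𝔸ˣ) : 𝔸))
        (Ioo (-(ε / 2)) (ε / 2) ×ˢ univ) :=
      ((ContinuousLinearMap.mulLeftRight ℝ 𝔸).contDiff.comp_contDiffOn contDiffOn_const).clm_apply
        hgis
    have hform : (fun p : ℝ × EuclideanSpace ℝ (Fin 4) => A p.1 p.2) = fun p =>
        (ContinuousLinearMap.mulLeftRight ℝ 𝔸 (g p.1 p.2 : 𝔸) (((g p.1 p.2)⁻¹ : 𝔸ˣ) : 𝔸)).comp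
            (Ã p.1 p.2) -
          (ContinuousLinearMap.mulLeftRight ℝ 𝔸 (1 : 𝔸) (((g p.1 p.2)⁻¹ : 𝔸ˣ) : 𝔸)).comp
            (fderiv ℝ (fun y => (g p.1 y : 𝔸)) p.2) := rfl
    rw [hform]
    exact ((hml.mono hsub1).clm_comp (hÃs.mono hsub2)).sub
      ((hml1.mono hsub1).clm_comp (hDg.mono hsub1))
  · -- periodicity
    intro t ht0 ht x i
    have ht' : t ∈ Ico (0 : ℝ) (ε / 2) := ⟨ht0, ht⟩
    have hg1 : g t (x + EuclideanSpace.single i L) = g t x := hgper t ht' x i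
    have hg2 : fderiv ℝ (fun y => (g t y : 𝔸)) (x + EuclideanSpace.single i L) =
        fderiv ℝ (fun y => (g t y : 𝔸)) x :=
      fderiv_comp_add_eq_of_forall (u := fun y => (g t y : 𝔸))
        (fun y => by rw [hgper t ht' y i]) x
    have hÃ1 : Ã t (x + EuclideanSpace.single i L) = Ã t x := hÃp t ht0 (ht.trans hε2') x i
    show gaugeAct (g t) (Ã t) (x + EuclideanSpace.single i L) = gaugeAct (g t) (Ã t) x
    ext v
    simp only [gaugeAct_apply, hg1, hg2, hÃ1]
  · -- `𝔲`-values: `g` is unitary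
    intro t ht0 ht x v
    have ht' : t ∈ Ico (0 : ℝ) (ε / 2) := ⟨ht0.le, ht⟩
    have hGs := hgstar t ht'
    have h1 : (g t x : 𝔸) * Ã t x v * (((g t x)⁻¹ : 𝔸ˣ) : 𝔸) ∈ 𝔲 := by
      rw [← hGs x]
      exact skewAdjoint.conjugate (hÃv t ht0.le (ht.trans hε2') x v) _
    have h2 : fderiv ℝ (fun y => (g t y : 𝔸)) x v * (((g t x)⁻¹ : 𝔸ˣ) : 𝔸) ∈ 𝔲 := by
      have hjd : DifferentiableAt ℝ (fun p : ℝ × EuclideanSpace ℝ (Fin 4) => (g p.1 p.2 : 𝔸)) (t, x) :=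
        (hgs.differentiableOn (by simp)).differentiableAt
          ((isOpen_Ioo.prod isOpen_univ).mem_nhds ⟨⟨by linarith, ht⟩, mem_univ x⟩)
      have hGd : DifferentiableAt ℝ (fun y => (g t y : 𝔸)) x :=
        hjd.comp x ((differentiableAt_const t).prodMk differentiableAt_id)
      obtain ⟨hSd, hSf⟩ := fderiv_star_comp_apply hGd
      have hconst : (fun y => (g t y : 𝔸) * star (g t y : 𝔸)) = fun _ => (1 : 𝔸) :=
        funext fun y => hgunit t ht' y
      have hzero : fderiv ℝ (fun y => (g t y : 𝔸) * star (g t y : 𝔸)) x v = 0 := by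
        rw [hconst]
        simp
      rw [(hGd.hasFDerivAt.fun_mul' hSd.hasFDerivAt).fderiv] at hzero
      simp only [add_apply, smul_apply, smul_eq_mul, op_smul_eq_mul, hSf v] at hzero
      refine skewAdjoint.mem_iff.mpr ?_
      rw [← hGs x, star_mul, star_star]
      exact eq_neg_of_add_eq_zero_left hzero
    show gaugeAct (g t) (Ã t) x v ∈ 𝔲
    rw [gaugeAct_apply]
    exact 𝔲.sub_mem h1 h2
  · -- the Yang–Mills heat flow: gauge away the DeTurck term
    intro t ht0 ht x v
    have hU : IsOpen (Ioo (0 : ℝ) (ε / 2)) := isOpen_Ioo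
    have hgU : ContDiffOn ℝ ∞ (fun p : ℝ × EuclideanSpace ℝ (Fin 4) => (g p.1 p.2 : 𝔸))
        (Ioo 0 (ε / 2) ×ˢ univ) :=
      hgs.mono (prod_mono (fun s hs => ⟨by linarith [hs.1], hs.2⟩) le_rfl)
    have hodeU : ∀ s ∈ Ioo (0 : ℝ) (ε / 2), ∀ y : EuclideanSpace ℝ (Fin 4),
        deriv (fun s' => (g s' y : 𝔸)) s = (g s y : 𝔸) * φ s y :=
      fun s hs y => (hgd s ⟨hs.1.le, hs.2⟩ y).deriv
    have hφU : ∀ s ∈ Ioo (0 : ℝ) (ε / 2), Differentiable ℝ (φ s) := by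
      intro s hs
      have h1 : ContDiff ℝ ∞ (φ s) := by
        have : φ s = (fun p : ℝ × EuclideanSpace ℝ (Fin 4) => φ p.1 p.2) ∘ fun y => (s, y) := rfl
        rw [this]
        exact hφs.comp_contDiff (contDiff_const.prodMk contDiff_id)
          fun y => ⟨⟨hs.1.le, hs.2.trans hε2'⟩, mem_univ y⟩
      exact h1.differentiable (by simp)
    have hÃU : ∀ s ∈ Ioo (0 : ℝ) (ε / 2), ContDiff ℝ 2 (Ã s) := fun s hs =>
      (contDiff_slice_of_contDiffOn_prod hÃs ⟨hs.1.le, hs.2.trans hε2'⟩).of_le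
        (WithTop.coe_le_coe.mpr le_top)
    have hÃtU : ∀ s ∈ Ioo (0 : ℝ) (ε / 2), ∀ y w : EuclideanSpace ℝ (Fin 4),
        DifferentiableAt ℝ (fun s' => Ã s' y w) s := by
      intro s hs y w
      have hO : IsOpen (Ioo (0 : ℝ) ε ×ˢ (univ : Set (EuclideanSpace ℝ (Fin 4)))) :=
        isOpen_Ioo.prod isOpen_univ
      exact (hasDerivAt_slice_apply hO (hÃs.mono (prod_mono Ioo_subset_Ico_self le_rfl)) (by simp)
        ⟨⟨hs.1, hs.2.trans hε2'⟩, mem_univ y⟩ w).differentiableAt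
    have hpdeU : ∀ s ∈ Ioo (0 : ℝ) (ε / 2), ∀ y w : EuclideanSpace ℝ (Fin 4),
        deriv (fun s' => Ã s' y w) s = divCurvature (Ã s) y w + covDeriv (Ã s) (φ s) y w := by
      intro s hs y w
      rw [hÃpde s hs.1 (hs.2.trans hε2') y w]
      exact (hf₀eq A₀ (Ã s) hA₀2 (hÃU s hs) y w).symm
    exact (deriv_gaugeAct_tslice_eq_divCurvature hU hgU hodeU hφU hÃU hÃtU hpdeU ⟨ht0, ht⟩ x v).deriv

end ShortTime


/-! ### The named fact from semilinear parabolic theory and Waldron's Thm. 1.1 -/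

section Torus

open scoped Matrix.Norms.Frobenius

/-- **`Waldron2019_yangMillsFlow_flatTorus` from two analytic theorems, with everything else
proved.** The named fact (Waldron 2019, Cor. 1.2 with Struwe's short-time existence, for the
trivial `U(N)`-bundle over the flat torus `ℝ⁴/Lℤ⁴`) follows from
* `hSL` — **local well-posedness of semilinear heat systems on the flat torus** with smooth data
  (Taylor, *PDE III*, Ch. 15, §1; a standard parabolic theorem, here as a schema over the
  finite-dimensional coefficient algebra `𝔸`, a subspace `𝔤` of values, and smooth periodic
  nonlinearities `f(x, u, ∂u)` preserving `𝔤`): `∂ₜ u = Σᵢ ∂ᵢ∂ᵢ u + f(x, u, ∂u)` has, for smooth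
  periodic `𝔤`-valued data, a jointly smooth periodic `𝔤`-valued solution on some `[0, ε) × ℝ⁴`;
* `hW` — **Waldron 2019, Thm. 1.1, on the closed flat torus**, in the form used for Cor. 1.2:
  every classical solution on `[0, T) × ℝ⁴`, `T < ∞`, is the restriction of a map jointly smooth
  on `[0, T] × ℝ⁴`;
by the DeTurck trick (`shortTime_of_semilinearHeat`: short-time existence for the Yang–Mills heat
flow, Struwe 1994 §4 / Donaldson–Kronheimer §6.3.1, PROVED from `hSL`) and the continuation
argument (`Waldron2019_yangMillsFlow_flatTorus_of_shortTime_of_smoothExtension`, PROVED from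
`hW`). Of Waldron's architecture — (S1) short-time existence, (S2) energy identity, (S3) Thm. 1.1,
(S4) continuation, (S5) assembly — only the two genuinely parabolic inputs remain hypotheses:
the semilinear existence theorem behind (S1), and (S3).
[cite: Waldron2019, Thm. 1.1, Cor. 1.2, p. 3] [cite: Struwe1994, §4.1]
[cite: DonaldsonKronheimer1990, §6.3.1] [cite: TaylorPDEIII2011, Ch. 15, §1] -/
theorem Waldron2019_yangMillsFlow_flatTorus_of_semilinearHeat_of_smoothExtension
    (hSL : ∀ {𝔸 : Type} [NormedRing 𝔸] [NormedAlgebra ℝ 𝔸] [FiniteDimensional ℝ 𝔸]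
      (𝔤 : Submodule ℝ 𝔸) (L : ℝ), 0 < L →
      ∀ f : EuclideanSpace ℝ (Fin 4) × (EuclideanSpace ℝ (Fin 4) →L[ℝ] 𝔸) ×
          (EuclideanSpace ℝ (Fin 4) →L[ℝ] EuclideanSpace ℝ (Fin 4) →L[ℝ] 𝔸) →
          (EuclideanSpace ℝ (Fin 4) →L[ℝ] 𝔸),
        ContDiff ℝ ∞ f →
        (∀ (x : EuclideanSpace ℝ (Fin 4)) (i : Fin 4) (a : EuclideanSpace ℝ (Fin 4) →L[ℝ] 𝔸)
            (p : EuclideanSpace ℝ (Fin 4) →L[ℝ] EuclideanSpace ℝ (Fin 4) →L[ℝ] 𝔸),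
          f (x + EuclideanSpace.single i L, a, p) = f (x, a, p)) →
        (∀ (x : EuclideanSpace ℝ (Fin 4)) (a : EuclideanSpace ℝ (Fin 4) →L[ℝ] 𝔸)
            (p : EuclideanSpace ℝ (Fin 4) →L[ℝ] EuclideanSpace ℝ (Fin 4) →L[ℝ] 𝔸),
          (∀ v, a v ∈ 𝔤) → (∀ u v, p u v ∈ 𝔤) → ∀ v, f (x, a, p) v ∈ 𝔤) →
        ∀ u₀ : Connection (EuclideanSpace ℝ (Fin 4)) 𝔸, IsSmoothConnection u₀ →
          u₀.IsValuedIn 𝔤 → u₀.IsLatticePeriodic L →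
          ∃ ε : ℝ, 0 < ε ∧ ∃ u : ℝ → Connection (EuclideanSpace ℝ (Fin 4)) 𝔸,
            u 0 = u₀ ∧
            ContDiffOn ℝ ∞ (fun p : ℝ × EuclideanSpace ℝ (Fin 4) => u p.1 p.2) (Ico 0 ε ×ˢ univ) ∧
            (∀ t : ℝ, 0 ≤ t → t < ε → (u t).IsLatticePeriodic L) ∧
            (∀ t : ℝ, 0 ≤ t → t < ε → (u t).IsValuedIn 𝔤) ∧
            ∀ t : ℝ, 0 < t → t < ε → ∀ x v : EuclideanSpace ℝ (Fin 4),
              deriv (fun s => u s x v) t =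
                (∑ i, fderiv ℝ (fderiv ℝ (u t)) x (stdOrthonormalBasis ℝ (EuclideanSpace ℝ (Fin 4)) i)
                  (stdOrthonormalBasis ℝ (EuclideanSpace ℝ (Fin 4)) i)) v +
                f (x, u t x, fderiv ℝ (u t) x) v)
    (hW : ∀ (N : ℕ) (L : ℝ), 0 < L → ∀ T : ℝ, 0 < T →
      ∀ B : ℝ → Connection (EuclideanSpace ℝ (Fin 4)) (Matrix (Fin N) (Fin N) ℂ),
        ContDiffOn ℝ ∞ (fun p : ℝ × EuclideanSpace ℝ (Fin 4) => B p.1 p.2) (Ico 0 T ×ˢ univ) →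
        (∀ t : ℝ, 0 ≤ t → t < T → (B t).IsLatticePeriodic L) →
        (∀ t : ℝ, 0 < t → t < T →
          (B t).IsValuedIn (skewAdjoint.submodule ℝ (Matrix (Fin N) (Fin N) ℂ))) →
        (∀ t : ℝ, 0 < t → t < T → ∀ x v : EuclideanSpace ℝ (Fin 4),
          deriv (fun s => B s x v) t = divCurvature (B t) x v) →
        ∃ B' : ℝ → Connection (EuclideanSpace ℝ (Fin 4)) (Matrix (Fin N) (Fin N) ℂ),
          (∀ t : ℝ, 0 ≤ t → t < T → B' t = B t) ∧
          ContDiffOn ℝ ∞ (fun p : ℝ × EuclideanSpace ℝ (Fin 4) => B' p.1 p.2)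
            (Icc 0 T ×ˢ univ)) :
    Waldron2019_yangMillsFlow_flatTorus :=
  Waldron2019_yangMillsFlow_flatTorus_of_shortTime_of_smoothExtension
    (fun N L hL A₀ hs hv hp =>
      shortTime_of_semilinearHeat (𝔸 := Matrix (Fin N) (Fin N) ℂ) (fun 𝔤 L' hL' => hSL 𝔤 L' hL')
        L hL A₀ hs hv hp)
    hW

end Torus

end Literature.MathematicalPhysics.QuantumLattice
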